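import Mathlib
import Summits.AtomisticToContinuum.Crystallization.Theses.ShellTopologyTrichotomy

/-!
# InterfaceTextureTrichotomy — the shell-topology split of the mesoscopic-composite cell (decomp-a2c lens-2, generation 11)

Tree twin of the cell node «ShellTopologyTrichotomy» (run/shared/lean/pub/decomp-a2c/decomp-a2c-lens-2/g11/ShellTopologyTrichotomy.lean,
sha256 recorded on the cell bus) for the CHILD ROUTE `Theses.ShellTopologyTrichotomy` of `Theses.InterfaceTextureTrichotomy`.  Sorry-free, no new
definitions; every statement is over the two gate-written route modules BY NAME.

* `mesoscopicCompositeCase_of_children` — the three cells of the child route give the parent's layer-2 item K₃ = `MesoscopicCompositeCase`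
  (stmt-AtomisticToContinuum-33646): `OctahedralCompositeCase → MixedShellCompositeCase → TcpCentreCompositeCase → MesoscopicCompositeCase`
  (excluded middle on 𝔒 = «coarse-minority all-bad balls of every radius with all-OCTAHEDRAL coarse sites recur», then on 𝔓 = «… with all
  non-T coarse sites recur»; shell-mate counts at the lineage's τ = 27/20, thresholds ≤ 4 / ≥ 5).
* `mesoscopicCompositeCase_iff_children` — the split is EXACT: K₃ ⟺ P₁ ∧ P₂ ∧ P₃ (stmt-33646 ⟺ 26476 ∧ 26477 ∧ 26475).
* `nonMesoscopicCase_iff_rest` — the child route's complement item `NonMesoscopicCase` (stmt-26478) is EXACTLY the conjunction of the parent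
  route's seven other items S ∧ G ∧ A ∧ K₁ ∧ K₂ ∧ T ∧ MatrixCase: it carries no content of its own and closes when they close.
* `assembly_proof` — PROVES the child route's assembly item `ShellTopologyTrichotomy.Assembly` (stmt-26479) from the route's own deciding theorem
  `ShellTopologyTrichotomy.closes` (4 binders).
* `crystallization_of_cells` — the conjunct from the parent's items with K₃ rebuilt from the three cells (10 binders, via the parent's deciding
  theorem `InterfaceTextureTrichotomy.closes` and the composite cell rebuilt from K₁, K₂ and the three cells; route modules only — no Theorems-on-route
  import chain).
-/

namespace Summit.AtomisticToContinuum.Crystallization.Theorems.InterfaceTextureTrichotomyShellTopology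

/-- children ⟹ K₃ (stmt-33646), by excluded middle twice (the case propositions are fixed by unification with the cells' hypotheses). -/
theorem mesoscopicCompositeCase_of_children (h₁ : Theses.ShellTopologyTrichotomy.OctahedralCompositeCase) (h₂ : Theses.ShellTopologyTrichotomy.MixedShellCompositeCase)
    (h₃ : Theses.ShellTopologyTrichotomy.TcpCentreCompositeCase) : Theses.InterfaceTextureTrichotomy.MesoscopicCompositeCase := by
  intro x Gd Nd hx h2 h50 hH hT hY hW hN
  refine (Classical.em _).elim (h₁ x hx h2 h50 hH hT hY hW hN) (fun hO => ?_)
  exact (Classical.em _).elim (h₂ x hx h2 h50 hH hT hY hW hN hO) (h₃ x hx h2 h50 hH hT hY hW hN hO)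

/-- K₃ ⟹ P₁ (P₁ is K₃ with one extra hypothesis). -/
theorem octahedralCompositeCase_of_mesoscopicCompositeCase (h : Theses.InterfaceTextureTrichotomy.MesoscopicCompositeCase) : Theses.ShellTopologyTrichotomy.OctahedralCompositeCase :=
  fun x hx h2 h50 hH hT hY hW hN _ => h x hx h2 h50 hH hT hY hW hN

/-- K₃ ⟹ P₂. -/
theorem mixedShellCompositeCase_of_mesoscopicCompositeCase (h : Theses.InterfaceTextureTrichotomy.MesoscopicCompositeCase) : Theses.ShellTopologyTrichotomy.MixedShellCompositeCase :=
  fun x hx h2 h50 hH hT hY hW hN _ _ => h x hx h2 h50 hH hT hY hW hN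

/-- K₃ ⟹ P₃. -/
theorem tcpCentreCompositeCase_of_mesoscopicCompositeCase (h : Theses.InterfaceTextureTrichotomy.MesoscopicCompositeCase) : Theses.ShellTopologyTrichotomy.TcpCentreCompositeCase :=
  fun x hx h2 h50 hH hT hY hW hN _ _ => h x hx h2 h50 hH hT hY hW hN

/-- **EXACTNESS**: K₃ (stmt-33646) is equivalent to the conjunction of the child route's three cells (stmt-26476 ∧ 26477 ∧ 26475). -/
theorem mesoscopicCompositeCase_iff_children :
    Theses.InterfaceTextureTrichotomy.MesoscopicCompositeCase ↔
      (Theses.ShellTopologyTrichotomy.OctahedralCompositeCase ∧ Theses.ShellTopologyTrichotomy.MixedShellCompositeCase ∧ Theses.ShellTopologyTrichotomy.TcpCentreCompositeCase) :=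
  ⟨fun h => ⟨octahedralCompositeCase_of_mesoscopicCompositeCase h, mixedShellCompositeCase_of_mesoscopicCompositeCase h,
      tcpCentreCompositeCase_of_mesoscopicCompositeCase h⟩,
    fun h => mesoscopicCompositeCase_of_children h.1 h.2.1 h.2.2⟩

/-- the complement item ⟹ each of the parent route's seven other items (each excludes K₃'s world by one of its own hypotheses; for
`MatrixCase`: a recurring coarse-minority all-bad ball meets the eventual 1/20-good R₁-net). -/
theorem rest_of_nonMesoscopicCase (h₀ : Theses.ShellTopologyTrichotomy.NonMesoscopicCase) :
    Theses.InterfaceTextureTrichotomy.CoarseSparseBulkCase ∧ Theses.InterfaceTextureTrichotomy.GrainyTextureCase ∧ Theses.InterfaceTextureTrichotomy.ThinTextureCase ∧ Theses.InterfaceTextureTrichotomy.TexturedGrainCase ∧ Theses.InterfaceTextureTrichotomy.IrregularGrainCase ∧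
      Theses.InterfaceTextureTrichotomy.CoarseMajorityBulkCase ∧ Theses.InterfaceTextureTrichotomy.MatrixCase := by
  refine ⟨fun x hx h50 => h₀ x hx fun hm => hm.2.1 h50, fun x hx hH _ => h₀ x hx fun hm => hm.2.2.1 hH,
    fun x hx hT _ _ => h₀ x hx fun hm => hm.2.2.2.1 hT, fun x hx _ _ _ _ hyw => h₀ x hx fun hm => hyw.elim hm.2.2.2.2.1 hm.2.2.2.2.2.1,
    fun x hx _ _ _ _ _ _ hn => h₀ x hx fun hm => hm.2.2.2.2.2.2 hn, fun x hx _ h2 => h₀ x hx fun hm => h2 hm.1, fun x hx hmat => h₀ x hx fun hm => ?_⟩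
  obtain ⟨R₁, hR₁⟩ := hmat
  obtain ⟨N, ⟨i, hb, -⟩, hN⟩ := ((hm.1 R₁).and_eventually hR₁).exists
  obtain ⟨j, hj, hg⟩ := hN i
  exact hb j hj hg

/-- … and conversely the seven items give the complement item (the lineage's partition of the ground-state sequences:
𝔊_(1/50) → S; ¬𝔊_(1/2): BULK → T, else MatrixCase; ℌ → G; 𝔗 → A; 𝔜 ∨ 𝔚 → K₁; 𝔑 → K₂; otherwise the sequence is IN K₃'s world). -/
theorem nonMesoscopicCase_of_rest (h_S : Theses.InterfaceTextureTrichotomy.CoarseSparseBulkCase) (h_G : Theses.InterfaceTextureTrichotomy.GrainyTextureCase) (h_A : Theses.InterfaceTextureTrichotomy.ThinTextureCase)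
    (h_K₁ : Theses.InterfaceTextureTrichotomy.TexturedGrainCase) (h_K₂ : Theses.InterfaceTextureTrichotomy.IrregularGrainCase) (h_T : Theses.InterfaceTextureTrichotomy.CoarseMajorityBulkCase) (h_Mat : Theses.InterfaceTextureTrichotomy.MatrixCase) :
    Theses.ShellTopologyTrichotomy.NonMesoscopicCase := by
  intro x Gd Nd hx hm
  by_cases h50 : ∀ R : ℝ, ∃ᶠ N in Filter.atTop, ∃ i : Fin N, (∀ j : Fin N, dist (x N j) (x N i) ≤ R → ¬ (let d : ℝ := sInf ((fun z => dist z (x N j)) '' (Set.range (x N) \ {(x N j)})); let T : Set (EuclideanSpace ℝ (Fin 3)) := {z : EuclideanSpace ℝ (Fin 3) | z ∈ Set.range (x N) ∧ z ≠ (x N j) ∧ dist z (x N j) < 13 / 10 * d}; ∃ A : EuclideanSpace ℝ (Fin 3) →ₗᵢ[ℝ] EuclideanSpace ℝ (Fin 3), (∃ e : ↥T ≃ ↥Literature.Geometry.DiscreteGeometry.fccKissingPattern, ∀ t : ↥T, dist (d⁻¹ • ((t : EuclideanSpace ℝ (Fin 3)) - (x N j))) (A ((e t : ↥Literature.Geometry.DiscreteGeometry.fccKissingPattern)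 : EuclideanSpace ℝ (Fin 3))) ≤ 1 / 20) ∨ (∃ e : ↥T ≃ ↥Literature.Geometry.DiscreteGeometry.hcpKissingPattern, ∀ t : ↥T, dist (d⁻¹ • ((t : EuclideanSpace ℝ (Fin 3)) - (x N j))) (A ((e t : ↥Literature.Geometry.DiscreteGeometry.hcpKissingPattern) : EuclideanSpace ℝ (Fin 3))) ≤ 1 / 20))) ∧ (Nat.card {j : Fin N // dist (x N j) (x N i) ≤ R ∧ ¬ (let d : ℝ := sInf ((fun z => dist z (x N j)) '' (Set.range (x N) \ {(x N j)})); let T : Set (EuclideanSpace ℝ (Fin 3)) := {z : EuclideanSpace ℝ (Fin 3) | z ∈ Set.range (x N) ∧ z ≠ (x N j) ∧ dist z (x N j) < 13 / 10 * d}; ∃ A : EuclideanSpace ℝ (Fin 3) →ₗᵢ[ℝ] EuclideanSpace ℝ (Fin 3), (∃ e : ↥T ≃ ↥Literature.Geometry.DiscreteGeometry.fccKissingPattern, ∀ t : ↥T, dist (d⁻¹ • ((t : EuclideanSpace ℝ (Fin 3)) - (x N j))) (A ((e t : ↥Literature.Geometry.DiscreteGeometry.fccKissingPattern) : EuclideanSpace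 ℝ (Fin 3))) ≤ 1 / 8) ∨ (∃ e : ↥T ≃ ↥Literature.Geometry.DiscreteGeometry.hcpKissingPattern, ∀ t : ↥T, dist (d⁻¹ • ((t : EuclideanSpace ℝ (Fin 3)) - (x N j))) (A ((e t : ↥Literature.Geometry.DiscreteGeometry.hcpKissingPattern) : EuclideanSpace ℝ (Fin 3))) ≤ 1 / 8))} : ℝ) ≤ 1 / 50 * (Nat.card {j : Fin N // dist (x N j) (x N i) ≤ R} : ℝ)
  · exact h_S x hx h50
  by_cases h2 : ∀ R : ℝ, ∃ᶠ N in Filter.atTop, ∃ i : Fin N, (∀ j : Fin N, dist (x N j) (x N i) ≤ R → ¬ (let d : ℝ := sInf ((fun z => dist z (x N j)) '' (Set.range (x N) \ {(x N j)})); let T : Set (EuclideanSpace ℝ (Fin 3)) := {z : EuclideanSpace ℝ (Fin 3) | z ∈ Set.range (x N) ∧ z ≠ (x N j) ∧ dist z (x N j) < 13 / 10 * d}; ∃ A : EuclideanSpace ℝ (Fin 3) →ₗᵢ[ℝ] EuclideanSpace ℝ (Fin 3), (∃ e : ↥T ≃ ↥Literature.Geometry.DiscreteGeometry.fccKissingPattern,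 ∀ t : ↥T, dist (d⁻¹ • ((t : EuclideanSpace ℝ (Fin 3)) - (x N j))) (A ((e t : ↥Literature.Geometry.DiscreteGeometry.fccKissingPattern) : EuclideanSpace ℝ (Fin 3))) ≤ 1 / 20) ∨ (∃ e : ↥T ≃ ↥Literature.Geometry.DiscreteGeometry.hcpKissingPattern, ∀ t : ↥T, dist (d⁻¹ • ((t : EuclideanSpace ℝ (Fin 3)) - (x N j))) (A ((e t : ↥Literature.Geometry.DiscreteGeometry.hcpKissingPattern) : EuclideanSpace ℝ (Fin 3))) ≤ 1 / 20))) ∧ (Nat.card {j : Fin N // dist (x N j) (x N i) ≤ R ∧ ¬ (let d : ℝ := sInf ((fun z => dist z (x N j)) '' (Set.range (x N) \ {(x N j)})); let T : Set (EuclideanSpace ℝ (Fin 3)) := {z : EuclideanSpace ℝ (Fin 3) | z ∈ Set.range (x N) ∧ z ≠ (x N j) ∧ dist z (x N j) < 13 / 10 * d}; ∃ A : EuclideanSpace ℝ (Fin 3) →ₗᵢ[ℝ] EuclideanSpace ℝ (Fin 3), (∃ e : ↥T ≃ ↥Literature.Geometry.DiscreteGeometry.fccKissingPattern, ∀ t :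 ↥T, dist (d⁻¹ • ((t : EuclideanSpace ℝ (Fin 3)) - (x N j))) (A ((e t : ↥Literature.Geometry.DiscreteGeometry.fccKissingPattern) : EuclideanSpace ℝ (Fin 3))) ≤ 1 / 8) ∨ (∃ e : ↥T ≃ ↥Literature.Geometry.DiscreteGeometry.hcpKissingPattern, ∀ t : ↥T, dist (d⁻¹ • ((t : EuclideanSpace ℝ (Fin 3)) - (x N j))) (A ((e t : ↥Literature.Geometry.DiscreteGeometry.hcpKissingPattern) : EuclideanSpace ℝ (Fin 3))) ≤ 1 / 8))} : ℝ) ≤ 1 / 2 * (Nat.card {j : Fin N // dist (x N j) (x N i) ≤ R} : ℝ)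
  · by_cases hH : ∀ R : ℝ, ∃ᶠ N in Filter.atTop, ∃ i : Fin N, (∀ j : Fin N, dist (x N j) (x N i) ≤ R → ¬ (let d : ℝ := sInf ((fun z => dist z (x N j)) '' (Set.range (x N) \ {(x N j)})); let T : Set (EuclideanSpace ℝ (Fin 3)) := {z : EuclideanSpace ℝ (Fin 3) | z ∈ Set.range (x N) ∧ z ≠ (x N j) ∧ dist z (x N j) < 13 / 10 * d}; ∃ A : EuclideanSpace ℝ (Fin 3) →ₗᵢ[ℝ] EuclideanSpace ℝ (Fin 3), (∃ e : ↥T ≃ ↥Literature.Geometry.DiscreteGeometry.fccKissingPattern, ∀ t : ↥T, dist (d⁻¹ • ((t : EuclideanSpace ℝ (Fin 3)) - (x N j))) (A ((e t : ↥Literature.Geometry.DiscreteGeometry.fccKissingPattern) : EuclideanSpace ℝ (Fin 3))) ≤ 1 / 20) ∨ (∃ e : ↥T ≃ ↥Literature.Geometry.DiscreteGeometry.hcpKissingPattern, ∀ t : ↥T, dist (d⁻¹ • ((t : EuclideanSpace ℝ (Fin 3)) - (x N j))) (A ((e t : ↥Literature.Geometry.DiscreteGeometry.hcpKissingPattern)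 : EuclideanSpace ℝ (Fin 3))) ≤ 1 / 20))) ∧ (Nat.card {j : Fin N // dist (x N j) (x N i) ≤ R ∧ ¬ (let d : ℝ := sInf ((fun z => dist z (x N j)) '' (Set.range (x N) \ {(x N j)})); let T : Set (EuclideanSpace ℝ (Fin 3)) := {z : EuclideanSpace ℝ (Fin 3) | z ∈ Set.range (x N) ∧ z ≠ (x N j) ∧ dist z (x N j) < 13 / 10 * d}; ∃ A : EuclideanSpace ℝ (Fin 3) →ₗᵢ[ℝ] EuclideanSpace ℝ (Fin 3), (∃ e : ↥T ≃ ↥Literature.Geometry.DiscreteGeometry.fccKissingPattern, ∀ t : ↥T, dist (d⁻¹ • ((t : EuclideanSpace ℝ (Fin 3)) - (x N j))) (A ((e t : ↥Literature.Geometry.DiscreteGeometry.fccKissingPattern) : EuclideanSpace ℝ (Fin 3))) ≤ 1 / 8) ∨ (∃ e : ↥T ≃ ↥Literature.Geometry.DiscreteGeometry.hcpKissingPattern, ∀ t : ↥T, dist (d⁻¹ • ((t : EuclideanSpace ℝ (Fin 3)) - (x N j))) (A ((e t : ↥Literature.Geometry.DiscreteGeometry.hcpKissingPattern) : EuclideanSpace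 ℝ (Fin 3))) ≤ 1 / 8))} : ℝ) ≤ 1 / 2 * (Nat.card {j : Fin N // dist (x N j) (x N i) ≤ R} : ℝ) ∧ (Nat.card {j : Fin N // dist (x N j) (x N i) ≤ R ∧ (let d : ℝ := sInf ((fun z => dist z (x N j)) '' (Set.range (x N) \ {(x N j)})); ∃ k : Fin N, x N k ≠ x N j ∧ dist (x N k) (x N j) < 13 / 10 * d ∧ ¬ ((let d : ℝ := sInf ((fun z => dist z (x N j)) '' (Set.range (x N) \ {(x N j)})); let T : Set (EuclideanSpace ℝ (Fin 3)) := {z : EuclideanSpace ℝ (Fin 3) | z ∈ Set.range (x N) ∧ z ≠ (x N j) ∧ dist z (x N j) < 13 / 10 * d}; ∃ A : EuclideanSpace ℝ (Fin 3) →ₗᵢ[ℝ] EuclideanSpace ℝ (Fin 3), (∃ e : ↥T ≃ ↥Literature.Geometry.DiscreteGeometry.fccKissingPattern, ∀ t : ↥T, dist (d⁻¹ • ((t : EuclideanSpace ℝ (Fin 3)) - (x N j))) (A ((e t : ↥Literature.Geometry.DiscreteGeometry.fccKissingPattern) : EuclideanSpace ℝ (Fin 3))) ≤ 1 / 8) ∨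 (∃ e : ↥T ≃ ↥Literature.Geometry.DiscreteGeometry.hcpKissingPattern, ∀ t : ↥T, dist (d⁻¹ • ((t : EuclideanSpace ℝ (Fin 3)) - (x N j))) (A ((e t : ↥Literature.Geometry.DiscreteGeometry.hcpKissingPattern) : EuclideanSpace ℝ (Fin 3))) ≤ 1 / 8)) ↔ (let d : ℝ := sInf ((fun z => dist z (x N k)) '' (Set.range (x N) \ {(x N k)})); let T : Set (EuclideanSpace ℝ (Fin 3)) := {z : EuclideanSpace ℝ (Fin 3) | z ∈ Set.range (x N) ∧ z ≠ (x N k) ∧ dist z (x N k) < 13 / 10 * d}; ∃ A : EuclideanSpace ℝ (Fin 3) →ₗᵢ[ℝ] EuclideanSpace ℝ (Fin 3), (∃ e : ↥T ≃ ↥Literature.Geometry.DiscreteGeometry.fccKissingPattern, ∀ t : ↥T, dist (d⁻¹ • ((t : EuclideanSpace ℝ (Fin 3)) - (x N k))) (A ((e t : ↥Literature.Geometry.DiscreteGeometry.fccKissingPattern) : EuclideanSpace ℝ (Fin 3))) ≤ 1 / 8) ∨ (∃ e : ↥T ≃ ↥Literature.Geometry.DiscreteGeometry.hcpKissingPattern,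 ∀ t : ↥T, dist (d⁻¹ • ((t : EuclideanSpace ℝ (Fin 3)) - (x N k))) (A ((e t : ↥Literature.Geometry.DiscreteGeometry.hcpKissingPattern) : EuclideanSpace ℝ (Fin 3))) ≤ 1 / 8))))} : ℝ) ≤ 1 / 400 * (Nat.card {j : Fin N // dist (x N j) (x N i) ≤ R} : ℝ)
    · exact h_G x hx hH h50
    by_cases hT : ∀ R : ℝ, ∃ᶠ N in Filter.atTop, ∃ i : Fin N, (∀ j : Fin N, dist (x N j) (x N i) ≤ R → ¬ (let d : ℝ := sInf ((fun z => dist z (x N j)) '' (Set.range (x N) \ {(x N j)})); let T : Set (EuclideanSpace ℝ (Fin 3)) := {z : EuclideanSpace ℝ (Fin 3) | z ∈ Set.range (x N) ∧ z ≠ (x N j) ∧ dist z (x N j) < 13 / 10 * d}; ∃ A : EuclideanSpace ℝ (Fin 3) →ₗᵢ[ℝ] EuclideanSpace ℝ (Fin 3), (∃ e : ↥T ≃ ↥Literature.Geometry.DiscreteGeometry.fccKissingPattern, ∀ t : ↥T, dist (d⁻¹ • ((t : EuclideanSpace ℝ (Fin 3)) - (x N j))) (A ((e t : ↥Literature.Geometry.DiscreteGeometry.fccKissingPattern)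 : EuclideanSpace ℝ (Fin 3))) ≤ 1 / 20) ∨ (∃ e : ↥T ≃ ↥Literature.Geometry.DiscreteGeometry.hcpKissingPattern, ∀ t : ↥T, dist (d⁻¹ • ((t : EuclideanSpace ℝ (Fin 3)) - (x N j))) (A ((e t : ↥Literature.Geometry.DiscreteGeometry.hcpKissingPattern) : EuclideanSpace ℝ (Fin 3))) ≤ 1 / 20))) ∧ (Nat.card {j : Fin N // dist (x N j) (x N i) ≤ R ∧ ¬ (let d : ℝ := sInf ((fun z => dist z (x N j)) '' (Set.range (x N) \ {(x N j)})); let T : Set (EuclideanSpace ℝ (Fin 3)) := {z : EuclideanSpace ℝ (Fin 3) | z ∈ Set.range (x N) ∧ z ≠ (x N j) ∧ dist z (x N j) < 13 / 10 * d}; ∃ A : EuclideanSpace ℝ (Fin 3) →ₗᵢ[ℝ] EuclideanSpace ℝ (Fin 3), (∃ e : ↥T ≃ ↥Literature.Geometry.DiscreteGeometry.fccKissingPattern, ∀ t : ↥T, dist (d⁻¹ • ((t : EuclideanSpace ℝ (Fin 3)) - (x N j))) (A ((e t : ↥Literature.Geometry.DiscreteGeometry.fccKissingPattern) : EuclideanSpace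 ℝ (Fin 3))) ≤ 1 / 8) ∨ (∃ e : ↥T ≃ ↥Literature.Geometry.DiscreteGeometry.hcpKissingPattern, ∀ t : ↥T, dist (d⁻¹ • ((t : EuclideanSpace ℝ (Fin 3)) - (x N j))) (A ((e t : ↥Literature.Geometry.DiscreteGeometry.hcpKissingPattern) : EuclideanSpace ℝ (Fin 3))) ≤ 1 / 8))} : ℝ) ≤ 1 / 2 * (Nat.card {j : Fin N // dist (x N j) (x N i) ≤ R} : ℝ) ∧ (∀ j : Fin N, dist (x N j) (x N i) ≤ R → ¬ (let d : ℝ := sInf ((fun z => dist z (x N j)) '' (Set.range (x N) \ {(x N j)})); let T : Set (EuclideanSpace ℝ (Fin 3)) := {z : EuclideanSpace ℝ (Fin 3) | z ∈ Set.range (x N) ∧ z ≠ (x N j) ∧ dist z (x N j) < 13 / 10 * d}; ∃ A : EuclideanSpace ℝ (Fin 3) →ₗᵢ[ℝ] EuclideanSpace ℝ (Fin 3), (∃ e : ↥T ≃ ↥Literature.Geometry.DiscreteGeometry.fccKissingPattern, ∀ t : ↥T, dist (d⁻¹ • ((t : EuclideanSpace ℝ (Fin 3)) - (x N j))) (A ((e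 t : ↥Literature.Geometry.DiscreteGeometry.fccKissingPattern) : EuclideanSpace ℝ (Fin 3))) ≤ 1 / 8) ∨ (∃ e : ↥T ≃ ↥Literature.Geometry.DiscreteGeometry.hcpKissingPattern, ∀ t : ↥T, dist (d⁻¹ • ((t : EuclideanSpace ℝ (Fin 3)) - (x N j))) (A ((e t : ↥Literature.Geometry.DiscreteGeometry.hcpKissingPattern) : EuclideanSpace ℝ (Fin 3))) ≤ 1 / 8)) → (let d : ℝ := sInf ((fun z => dist z (x N j)) '' (Set.range (x N) \ {(x N j)})); ∃ k : Fin N, x N k ≠ x N j ∧ dist (x N k) (x N j) < 13 / 10 * d ∧ ¬ ((let d : ℝ := sInf ((fun z => dist z (x N j)) '' (Set.range (x N) \ {(x N j)})); let T : Set (EuclideanSpace ℝ (Fin 3)) := {z : EuclideanSpace ℝ (Fin 3) | z ∈ Set.range (x N) ∧ z ≠ (x N j) ∧ dist z (x N j) < 13 / 10 * d}; ∃ A : EuclideanSpace ℝ (Fin 3) →ₗᵢ[ℝ] EuclideanSpace ℝ (Fin 3), (∃ e : ↥T ≃ ↥Literature.Geometry.DiscreteGeometry.fccKissingPattern, ∀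 t : ↥T, dist (d⁻¹ • ((t : EuclideanSpace ℝ (Fin 3)) - (x N j))) (A ((e t : ↥Literature.Geometry.DiscreteGeometry.fccKissingPattern) : EuclideanSpace ℝ (Fin 3))) ≤ 1 / 8) ∨ (∃ e : ↥T ≃ ↥Literature.Geometry.DiscreteGeometry.hcpKissingPattern, ∀ t : ↥T, dist (d⁻¹ • ((t : EuclideanSpace ℝ (Fin 3)) - (x N j))) (A ((e t : ↥Literature.Geometry.DiscreteGeometry.hcpKissingPattern) : EuclideanSpace ℝ (Fin 3))) ≤ 1 / 8)) ↔ (let d : ℝ := sInf ((fun z => dist z (x N k)) '' (Set.range (x N) \ {(x N k)})); let T : Set (EuclideanSpace ℝ (Fin 3)) := {z : EuclideanSpace ℝ (Fin 3) | z ∈ Set.range (x N) ∧ z ≠ (x N k) ∧ dist z (x N k) < 13 / 10 * d}; ∃ A : EuclideanSpace ℝ (Fin 3) →ₗᵢ[ℝ] EuclideanSpace ℝ (Fin 3), (∃ e : ↥T ≃ ↥Literature.Geometry.DiscreteGeometry.fccKissingPattern, ∀ t : ↥T, dist (d⁻¹ • ((t : EuclideanSpace ℝ (Fin 3)) - (x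 N k))) (A ((e t : ↥Literature.Geometry.DiscreteGeometry.fccKissingPattern) : EuclideanSpace ℝ (Fin 3))) ≤ 1 / 8) ∨ (∃ e : ↥T ≃ ↥Literature.Geometry.DiscreteGeometry.hcpKissingPattern, ∀ t : ↥T, dist (d⁻¹ • ((t : EuclideanSpace ℝ (Fin 3)) - (x N k))) (A ((e t : ↥Literature.Geometry.DiscreteGeometry.hcpKissingPattern) : EuclideanSpace ℝ (Fin 3))) ≤ 1 / 8)))))
    · exact h_A x hx hT h50 hH
    by_cases hyw : (∀ R : ℝ, ∃ᶠ N in Filter.atTop, ∃ i : Fin N, (∀ j : Fin N, dist (x N j) (x N i) ≤ R → ¬ (let d : ℝ := sInf ((fun z => dist z (x N j)) '' (Set.range (x N) \ {(x N j)})); let T : Set (EuclideanSpace ℝ (Fin 3)) := {z : EuclideanSpace ℝ (Fin 3) | z ∈ Set.range (x N) ∧ z ≠ (x N j) ∧ dist z (x N j) < 13 / 10 * d}; ∃ A : EuclideanSpace ℝ (Fin 3) →ₗᵢ[ℝ] EuclideanSpace ℝ (Fin 3), (∃ e : ↥T ≃ ↥Literature.Geometry.DiscreteGeometry.fccKissingPattern,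 ∀ t : ↥T, dist (d⁻¹ • ((t : EuclideanSpace ℝ (Fin 3)) - (x N j))) (A ((e t : ↥Literature.Geometry.DiscreteGeometry.fccKissingPattern) : EuclideanSpace ℝ (Fin 3))) ≤ 1 / 20) ∨ (∃ e : ↥T ≃ ↥Literature.Geometry.DiscreteGeometry.hcpKissingPattern, ∀ t : ↥T, dist (d⁻¹ • ((t : EuclideanSpace ℝ (Fin 3)) - (x N j))) (A ((e t : ↥Literature.Geometry.DiscreteGeometry.hcpKissingPattern) : EuclideanSpace ℝ (Fin 3))) ≤ 1 / 20))) ∧ (∃ b : Fin 3 → EuclideanSpace ℝ (Fin 3), ∃ M : Finset (EuclideanSpace ℝ (Fin 3)), ∃ κ D : ℝ, 0 < κ ∧ (∀ i : Fin 3, ‖b i‖ ≤ D) ∧ (∀ m ∈ M, ‖m‖ ≤ D) ∧ (∀ w w' : Fin 3 → ℤ, ∀ m ∈ M, ∀ m' ∈ M, (w ≠ w' ∨ m ≠ m') → (1 / 2 : ℝ) ≤ dist ((∑ i : Fin 3, ((w i : ℤ) : ℝ) • b i) + m) ((∑ i : Fin 3, ((w' i : ℤ) : ℝ) • b i) + m'))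 ∧ (∃ K : ℕ, (∀ m ∈ M, ∀ m' ∈ M, ∀ w : Fin 3 → ℤ, ‖(∑ i : Fin 3, ((w i : ℤ) : ℝ) • b i) + m' - m‖ ≤ 8 → ∀ i : Fin 3, |w i| ≤ (K : ℤ)) ∧ (let Vrob : ℝ → ℝ := fun r : ℝ => if r + 1 / 500 ≤ 1 then Literature.MathematicalPhysics.StatisticalMechanics.lennardJones (r + 1 / 500) else if 1 ≤ r - 1 / 500 then Literature.MathematicalPhysics.StatisticalMechanics.lennardJones (r - 1 / 500) else -(1 / 12 : ℝ); ((M).card : ℝ) * (2 * (-(179 : ℝ) / 250) + 1 / 75) + κ * |Matrix.det (Matrix.of fun i j : Fin 3 => (b i) j)| ≤ ∑ m ∈ M, ∑ w ∈ Fintype.piFinset (fun _ : Fin 3 => Finset.Icc (-(K : ℤ)) K), ∑ m' ∈ M, (let v : EuclideanSpace ℝ (Fin 3) := (∑ i : Fin 3, ((w i : ℤ) : ℝ) • b i) + m' - m; if 0 < ‖v‖ ∧ ‖v‖ ≤ 8 then Vrob ‖v‖ else 0))) ∧ ∃ t : EuclideanSpace ℝ (Fin 3), let S : Set (EuclideanSpace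 ℝ (Fin 3)) := {p : EuclideanSpace ℝ (Fin 3) | ∃ w : Fin 3 → ℤ, ∃ m ∈ M, p = (∑ i : Fin 3, ((w i : ℤ) : ℝ) • b i) + m + t}; let ℓ : ℝ := 10000 * (1 + D) * (1 + 1 / κ); (∀ p ∈ S, dist p (x N i) ≤ ℓ → ∃ k : Fin N, dist (x N k) p ≤ 1 / 1000) ∧ (∀ k : Fin N, dist (x N k) (x N i) ≤ ℓ → ∃ p ∈ S, dist (x N k) p ≤ 1 / 1000))) ∨ (∀ R : ℝ, ∃ᶠ N in Filter.atTop, ∃ i : Fin N, (∀ j : Fin N, dist (x N j) (x N i) ≤ R → ¬ (let d : ℝ := sInf ((fun z => dist z (x N j)) '' (Set.range (x N) \ {(x N j)})); let T : Set (EuclideanSpace ℝ (Fin 3)) := {z : EuclideanSpace ℝ (Fin 3) | z ∈ Set.range (x N) ∧ z ≠ (x N j) ∧ dist z (x N j) < 13 / 10 * d}; ∃ A : EuclideanSpace ℝ (Fin 3) →ₗᵢ[ℝ] EuclideanSpace ℝ (Fin 3), (∃ e : ↥T ≃ ↥Literature.Geometry.DiscreteGeometry.fccKissingPattern, ∀ t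 : ↥T, dist (d⁻¹ • ((t : EuclideanSpace ℝ (Fin 3)) - (x N j))) (A ((e t : ↥Literature.Geometry.DiscreteGeometry.fccKissingPattern) : EuclideanSpace ℝ (Fin 3))) ≤ 1 / 20) ∨ (∃ e : ↥T ≃ ↥Literature.Geometry.DiscreteGeometry.hcpKissingPattern, ∀ t : ↥T, dist (d⁻¹ • ((t : EuclideanSpace ℝ (Fin 3)) - (x N j))) (A ((e t : ↥Literature.Geometry.DiscreteGeometry.hcpKissingPattern) : EuclideanSpace ℝ (Fin 3))) ≤ 1 / 20))) ∧ (∀ z : EuclideanSpace ℝ (Fin 3), dist z (x N i) ≤ R → ∃ k : Fin N, dist z (x N k) ≤ 1) ∧ (∀ j : Fin N, dist (x N j) (x N i) ≤ R → (let d : ℝ := sInf ((fun z => dist z (x N j)) '' (Set.range (x N) \ {(x N j)})); ∀ k : Fin N, x N k ≠ x N j → dist (x N k) (x N j) < 27 / 20 * d → 5 ≤ Nat.card {m : Fin N // x N m ≠ x N j ∧ dist (x N m) (x N j) < 27 / 20 * d ∧ x N m ≠ x N k ∧ dist (x N m) (x N k) < 27 / 20 * d})))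
    · exact h_K₁ x hx h2 h50 hH hT hyw
    by_cases hn : ∀ R : ℝ, ∃ᶠ N in Filter.atTop, ∃ i : Fin N, ∀ j : Fin N, dist (x N j) (x N i) ≤ R → ¬ (let d : ℝ := sInf ((fun z => dist z (x N j)) '' (Set.range (x N) \ {(x N j)})); let T : Set (EuclideanSpace ℝ (Fin 3)) := {z : EuclideanSpace ℝ (Fin 3) | z ∈ Set.range (x N) ∧ z ≠ (x N j) ∧ dist z (x N j) < 13 / 10 * d}; ∃ A : EuclideanSpace ℝ (Fin 3) →ₗᵢ[ℝ] EuclideanSpace ℝ (Fin 3), (∃ e : ↥T ≃ ↥Literature.Geometry.DiscreteGeometry.fccKissingPattern, ∀ t : ↥T, dist (d⁻¹ • ((t : EuclideanSpace ℝ (Fin 3)) - (x N j))) (A ((e t : ↥Literature.Geometry.DiscreteGeometry.fccKissingPattern) : EuclideanSpace ℝ (Fin 3))) ≤ 1 / 8) ∨ (∃ e : ↥T ≃ ↥Literature.Geometry.DiscreteGeometry.hcpKissingPattern, ∀ t : ↥T, dist (d⁻¹ • ((t : EuclideanSpace ℝ (Fin 3)) - (x N j))) (A ((e t : ↥Literature.Geometry.DiscreteGeometry.hcpKissingPattern)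 : EuclideanSpace ℝ (Fin 3))) ≤ 1 / 8))
    · exact h_K₂ x hx h2 h50 hH hT (fun h => hyw (Or.inl h)) (fun h => hyw (Or.inr h)) hn
    exact absurd ⟨h2, h50, hH, hT, fun h => hyw (Or.inl h), fun h => hyw (Or.inr h), hn⟩ hm
  · by_cases hb : ∀ R : ℝ, ∃ᶠ N in Filter.atTop, ∃ i : Fin N, ∀ j : Fin N, dist (x N j) (x N i) ≤ R → ¬ (let d : ℝ := sInf ((fun z => dist z (x N j)) '' (Set.range (x N) \ {(x N j)})); let T : Set (EuclideanSpace ℝ (Fin 3)) := {z : EuclideanSpace ℝ (Fin 3) | z ∈ Set.range (x N) ∧ z ≠ (x N j) ∧ dist z (x N j) < 13 / 10 * d}; ∃ A : EuclideanSpace ℝ (Fin 3) →ₗᵢ[ℝ] EuclideanSpace ℝ (Fin 3), (∃ e : ↥T ≃ ↥Literature.Geometry.DiscreteGeometry.fccKissingPattern, ∀ t : ↥T, dist (d⁻¹ • ((t : EuclideanSpace ℝ (Fin 3)) - (x N j))) (A ((e t : ↥Literature.Geometry.DiscreteGeometry.fccKissingPattern) : EuclideanSpace ℝ (Fin 3)))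 ≤ 1 / 20) ∨ (∃ e : ↥T ≃ ↥Literature.Geometry.DiscreteGeometry.hcpKissingPattern, ∀ t : ↥T, dist (d⁻¹ • ((t : EuclideanSpace ℝ (Fin 3)) - (x N j))) (A ((e t : ↥Literature.Geometry.DiscreteGeometry.hcpKissingPattern) : EuclideanSpace ℝ (Fin 3))) ≤ 1 / 20))
    · exact h_T x hx hb h2
    · have hmat : ∃ R₁ : ℝ, ∀ᶠ N in Filter.atTop, ∀ i : Fin N, ∃ j : Fin N, dist (x N j) (x N i) ≤ R₁ ∧ (let d : ℝ := sInf ((fun z => dist z (x N j)) '' (Set.range (x N) \ {(x N j)})); let T : Set (EuclideanSpace ℝ (Fin 3)) := {z : EuclideanSpace ℝ (Fin 3) | z ∈ Set.range (x N) ∧ z ≠ (x N j) ∧ dist z (x N j) < 13 / 10 * d}; ∃ A : EuclideanSpace ℝ (Fin 3) →ₗᵢ[ℝ] EuclideanSpace ℝ (Fin 3), (∃ e : ↥T ≃ ↥Literature.Geometry.DiscreteGeometry.fccKissingPattern, ∀ t : ↥T, dist (d⁻¹ • ((t : EuclideanSpace ℝ (Fin 3)) - (x N j))) (A ((e t : ↥Literature.Geometry.DiscreteGeometry.fccKissingPattern)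 : EuclideanSpace ℝ (Fin 3))) ≤ 1 / 20) ∨ (∃ e : ↥T ≃ ↥Literature.Geometry.DiscreteGeometry.hcpKissingPattern, ∀ t : ↥T, dist (d⁻¹ • ((t : EuclideanSpace ℝ (Fin 3)) - (x N j))) (A ((e t : ↥Literature.Geometry.DiscreteGeometry.hcpKissingPattern) : EuclideanSpace ℝ (Fin 3))) ≤ 1 / 20)) := by
        simp only [not_forall, Filter.not_frequently, not_exists, not_not] at hb
        obtain ⟨R₁, hR₁⟩ := hb
        exact ⟨R₁, hR₁.mono fun N hN i => by simpa [Classical.not_imp] using hN i⟩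
      exact h_Mat x hx hmat

/-- **The complement item is exact**: `NonMesoscopicCase` (stmt-26478) ⟺ S ∧ G ∧ A ∧ K₁ ∧ K₂ ∧ T ∧ MatrixCase of the parent route. -/
theorem nonMesoscopicCase_iff_rest :
    Theses.ShellTopologyTrichotomy.NonMesoscopicCase ↔
      (Theses.InterfaceTextureTrichotomy.CoarseSparseBulkCase ∧ Theses.InterfaceTextureTrichotomy.GrainyTextureCase ∧ Theses.InterfaceTextureTrichotomy.ThinTextureCase ∧ Theses.InterfaceTextureTrichotomy.TexturedGrainCase ∧ Theses.InterfaceTextureTrichotomy.IrregularGrainCase ∧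
        Theses.InterfaceTextureTrichotomy.CoarseMajorityBulkCase ∧ Theses.InterfaceTextureTrichotomy.MatrixCase) :=
  ⟨rest_of_nonMesoscopicCase, fun h => nonMesoscopicCase_of_rest h.1 h.2.1 h.2.2.1 h.2.2.2.1 h.2.2.2.2.1 h.2.2.2.2.2.1 h.2.2.2.2.2.2⟩

/-- the child route's assembly item (stmt-26479) from its own deciding theorem. -/
theorem assembly_proof : Theses.ShellTopologyTrichotomy.Assembly :=
  fun h₀ h₁ h₂ h₃ => Theses.ShellTopologyTrichotomy.closes h₀ h₁ h₂ h₃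

/-- the parent's composite cell C (stmt-28575) from K₁, K₂ and the three cells (excluded middle on «textured grains recur», then on «all-coarse
balls of every radius recur»; same proof as the landed nodule-bulk glue, restated here to keep this file's imports route-only). -/
theorem compositeTextureCase_of_cells (h_K₁ : Theses.InterfaceTextureTrichotomy.TexturedGrainCase) (h_K₂ : Theses.InterfaceTextureTrichotomy.IrregularGrainCase)
    (h₁ : Theses.ShellTopologyTrichotomy.OctahedralCompositeCase) (h₂ : Theses.ShellTopologyTrichotomy.MixedShellCompositeCase) (h₃ : Theses.ShellTopologyTrichotomy.TcpCentreCompositeCase) :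
    Theses.InterfaceTextureTrichotomy.CompositeTextureCase := by
  have h₃' := mesoscopicCompositeCase_of_children h₁ h₂ h₃
  intro x hx h₂' h₅₀ hH hT
  refine (Classical.em _).elim (fun ht => h_K₁ x hx h₂' h₅₀ hH hT ht) (fun hn => ?_)
  exact (Classical.em _).elim (fun hg => h_K₂ x hx h₂' h₅₀ hH hT (fun hc => hn (Or.inl hc)) (fun hw => hn (Or.inr hw)) hg)
    (fun hg => h₃' x hx h₂' h₅₀ hH hT (fun hc => hn (Or.inl hc)) (fun hw => hn (Or.inr hw)) hg)

/-- the conjunct from the parent route's items with K₃ rebuilt from the three cells (10 binders). -/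
theorem crystallization_of_cells (h_S : Theses.InterfaceTextureTrichotomy.CoarseSparseBulkCase) (h_G : Theses.InterfaceTextureTrichotomy.GrainyTextureCase) (h_A : Theses.InterfaceTextureTrichotomy.ThinTextureCase)
    (h_K₁ : Theses.InterfaceTextureTrichotomy.TexturedGrainCase) (h_K₂ : Theses.InterfaceTextureTrichotomy.IrregularGrainCase)
    (h₁ : Theses.ShellTopologyTrichotomy.OctahedralCompositeCase) (h₂ : Theses.ShellTopologyTrichotomy.MixedShellCompositeCase) (h₃ : Theses.ShellTopologyTrichotomy.TcpCentreCompositeCase)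
    (h_T : Theses.InterfaceTextureTrichotomy.CoarseMajorityBulkCase) (h_Mat : Theses.InterfaceTextureTrichotomy.MatrixCase) : _root_.Crystallization :=
  Theses.InterfaceTextureTrichotomy.closes h_S h_G h_A (compositeTextureCase_of_cells h_K₁ h_K₂ h₁ h₂ h₃) h_T h_Mat

/-- the child route's four items are jointly EQUIVALENT to the parent route's ten-cell list (so the child route decides exactly what the parent does). -/
theorem childItems_iff_parentItems :
    (Theses.ShellTopologyTrichotomy.NonMesoscopicCase ∧ Theses.ShellTopologyTrichotomy.OctahedralCompositeCase ∧ Theses.ShellTopologyTrichotomy.MixedShellCompositeCase ∧ Theses.ShellTopologyTrichotomy.TcpCentreCompositeCase) ↔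
      (Theses.InterfaceTextureTrichotomy.CoarseSparseBulkCase ∧ Theses.InterfaceTextureTrichotomy.GrainyTextureCase ∧ Theses.InterfaceTextureTrichotomy.ThinTextureCase ∧ Theses.InterfaceTextureTrichotomy.TexturedGrainCase ∧ Theses.InterfaceTextureTrichotomy.IrregularGrainCase ∧
        Theses.InterfaceTextureTrichotomy.MesoscopicCompositeCase ∧ Theses.InterfaceTextureTrichotomy.CoarseMajorityBulkCase ∧ Theses.InterfaceTextureTrichotomy.MatrixCase) := by
  constructor
  · rintro ⟨h₀, h₁, h₂, h₃⟩
    obtain ⟨hS, hG, hA, hK₁, hK₂, hT, hM⟩ := rest_of_nonMesoscopicCase h₀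
    exact ⟨hS, hG, hA, hK₁, hK₂, mesoscopicCompositeCase_of_children h₁ h₂ h₃, hT, hM⟩
  · rintro ⟨hS, hG, hA, hK₁, hK₂, hK₃, hT, hM⟩
    exact ⟨nonMesoscopicCase_of_rest hS hG hA hK₁ hK₂ hT hM, octahedralCompositeCase_of_mesoscopicCompositeCase hK₃,
      mixedShellCompositeCase_of_mesoscopicCompositeCase hK₃, tcpCentreCompositeCase_of_mesoscopicCompositeCase hK₃⟩

end Summit.AtomisticToContinuum.Crystallization.Theorems.InterfaceTextureTrichotomyShellTopology
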